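import Mathlib
import HarnessLib
import Summits.HubbardSuperconductivity.HubbardSuperconductivity.Theorems.KLProgrammeKLRegimeSplitTwoLegSizesMSChainTableFrames

/-!
# Route `KLProgramme`, crux K3 — (E3a-MS) supplier chain, TUBE RE-KEY (T2): the chain's reading points lie in the flat tube of the frame
# (k3c3-p1 g4)

Seat hubbard-kl-k3c3-p1 (g4).  The (E3a-MS) chain at scale `n` reads the increment symbols only at the Fermi points of the chain frames
`K_k = msChain d Kp n N k` and on the segments between consecutive chain curves.  Here: those points lie in the tube `{q : |frameLevel μ K q| ≤ r}`
of the FULL frame `K` with an explicit radius.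

* `eval_sub_eval_msChain` — `K − K_k = Σ_{m ∈ Ioc (n+k) N} highPart d (Kp m)` (the not-yet-added high parts);
* `frameLevel_eq_frameLevel_msChain_sub` — `e_K(q) = e_{K_k}(q) − Σ_{m ∈ Ioc (n+k) N} (highPart d (Kp m))(q)`;
* **`abs_frameLevel_chainPoint_le`** — at a chain curve point `k_F^{K_k}(θ)`: `|frameLevel μ K| ≤ H := Σ_{m ∈ Ioc n N} e m 0` (`e m 0` = sup of
  the high part of piece `m`), since `frameLevel μ K_k` vanishes there (`frameLevel_klFermiPoint`);
* **`abs_frameLevel_le_of_mem_segment`** — on a segment `[x, y]` with `|frameLevel μ K y| ≤ H`, `‖y − x‖ ≤ W` and `‖D frameLevel μ K‖ ≤ G_l`: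
  `|frameLevel μ K z| ≤ H + G_l·W` (mean value on the segment).

Proofs only; nothing about the model.
-/

noncomputable section

namespace Summit.HubbardSuperconductivity.HubbardSuperconductivity.Theorems.KLRegimeSplit

set_option linter.dupNamespace false -- summit = problem name (single-conjunct summit), D-0017

open Real Finset Literature.MathematicalPhysics.QuantumLattice Literature.MathematicalPhysics.QuantumLattice.FermiRG
open Literature.MathematicalPhysics.QuantumLattice.BandSectorCounting
open Summit.HubbardSuperconductivity.HubbardSuperconductivity.Theorems.KLProgrammeLegKernels
open Summit.HubbardSuperconductivity.HubbardSuperconductivity.Theorems.DispersionFlow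
open Summit.HubbardSuperconductivity.HubbardSuperconductivity.Theorems.PerturbedFermiCurve

/-! ## §1 The frame minus a chain frame -/

section Chain

variable (d : ℕ) {K : TrigPolyC4v} {Kp : ℕ → TrigPolyC4v} {N : ℕ}
  (hK : ∀ p : Fin 2 → ℝ, K.eval p = ∑ m ∈ range (N + 1), (Kp m).eval p) {n : ℕ} (hnN : n ≤ N)
include hK hnN

/-- **`K − K_k` = the not-yet-added high parts**: `K(p) − (msChain d Kp n N k)(p) = Σ_{m ∈ Ioc (n+k) N} (highPart d (Kp m))(p)` (`k ≤ N − n`). -/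
theorem eval_sub_eval_msChain {k : ℕ} (hk : k ≤ N - n) (p : Fin 2 → ℝ) :
    K.eval p - (msChain d Kp n N k).eval p = ∑ m ∈ Ioc (n + k) N, (highPart d (Kp m)).eval p := by
  rw [← eval_msChain_last d hK hnN p, eval_msChain, eval_msChain, show n + (N - n) = N by omega]
  have h := Finset.sum_Ioc_consecutive (fun m => (highPart d (Kp m)).eval p) (show n ≤ n + k by omega) (show n + k ≤ N by omega)
  linarith

/-- **The frame band through a chain frame**: `frameLevel μ K q = frameLevel μ K_k q − Σ_{m ∈ Ioc (n+k) N} (highPart d (Kp m))(q)`. -/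
theorem frameLevel_eq_frameLevel_msChain_sub (μ : ℝ) {k : ℕ} (hk : k ≤ N - n) (q : Momentum) :
    frameLevel μ K q = frameLevel μ (msChain d Kp n N k) q - ∑ m ∈ Ioc (n + k) N, (highPart d (Kp m)).eval (WithLp.ofLp q) := by
  have h := eval_sub_eval_msChain d hK hnN hk (WithLp.ofLp q)
  simp only [frameLevel]
  linarith

/-- **AT A CHAIN CURVE POINT the frame band is small**: `|frameLevel μ K (k_F^{K_k}(θ))| ≤ Σ_{m ∈ Ioc n N} e m 0`, where `e m 0` bounds the sup of
the high part of piece `m`; the chain frame is in the band regime (`C²` size `A`, margins) so that `k_F^{K_k}(θ)` lies on its curve. -/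
theorem abs_frameLevel_chainPoint_le {μ : ℝ} {k : ℕ} (hk : k ≤ N - n) {A : ℝ}
    (hA : ∀ p : Momentum, ∀ j ≤ 2, ‖iteratedFDeriv ℝ j (frameShift (msChain d Kp n N k)) p‖ ≤ A)
    (hlo : (-1.1 : ℝ) ≤ μ - A) (hhi : μ + A ≤ -0.1)
    {e : ℕ → ℕ → ℝ} (he0 : ∀ m ∈ Ioc n N, ∀ q : Momentum, |evalM (highPart d (Kp m)) q| ≤ e m 0) (θ : ℝ) :
    |frameLevel μ K (WithLp.toLp 2 (klFermiPoint μ (msChain d Kp n N k) θ))| ≤ ∑ m ∈ Ioc n N, e m 0 := by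
  have hB := frameLevel_klFermiPoint (bandBounds (show (-4 : ℝ) < -1.1 by norm_num) (show (-1.1 : ℝ) ≤ -0.1 by norm_num)
    (show (-0.1 : ℝ) < 0 by norm_num)) hA hlo hhi θ
  rw [frameLevel_eq_frameLevel_msChain_sub d hK hnN μ hk, hB, zero_sub, abs_neg]
  have hsub : Ioc (n + k) N ⊆ Ioc n N := fun m hm => by
    simp only [Finset.mem_Ioc] at hm ⊢; omega
  calc |∑ m ∈ Ioc (n + k) N, (highPart d (Kp m)).eval (WithLp.ofLp (WithLp.toLp 2 (klFermiPoint μ (msChain d Kp n N k) θ)))|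
      ≤ ∑ m ∈ Ioc (n + k) N, |(highPart d (Kp m)).eval (WithLp.ofLp (WithLp.toLp 2 (klFermiPoint μ (msChain d Kp n N k) θ)))| :=
        Finset.abs_sum_le_sum_abs _ _
    _ ≤ ∑ m ∈ Ioc (n + k) N, e m 0 :=
        Finset.sum_le_sum fun m hm => he0 m (hsub hm) (WithLp.toLp 2 (klFermiPoint μ (msChain d Kp n N k) θ))
    _ ≤ ∑ m ∈ Ioc n N, e m 0 :=
        Finset.sum_le_sum_of_subset_of_nonneg hsub fun m hm _ =>
          (abs_nonneg _).trans (he0 m hm (WithLp.toLp 2 (klFermiPoint μ (msChain d Kp n N k) θ)))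

end Chain

/-! ## §2 The frame band along a segment -/

/-- The frame band is differentiable (free band: trigonometric; frame: a trigonometric polynomial). -/
theorem differentiable_frameLevel (μ : ℝ) (K : TrigPolyC4v) : Differentiable ℝ (frameLevel μ K) := by
  have h1 : Differentiable ℝ (squareDispersion 1 0 : Momentum → ℝ) := fun q => (hasGradientAt_squareDispersion q).differentiableAt
  have h2 : Differentiable ℝ (evalM K) := (contDiff_evalM K (k := 1)).differentiable one_ne_zero
  have e : frameLevel μ K = fun q => squareDispersion 1 0 q - μ - evalM K q := rfl
  rw [e]
  exact (h1.sub_const μ).sub h2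

/-- **ALONG A SEGMENT the frame band stays small**: if `|frameLevel μ K y| ≤ H`, `‖y − x‖ ≤ W` and `‖D frameLevel μ K‖ ≤ G_l` everywhere, then
`|frameLevel μ K z| ≤ H + G_l·W` for every `z ∈ [x, y]`. -/
theorem abs_frameLevel_le_of_mem_segment {μ : ℝ} {K : TrigPolyC4v} {Gl : ℝ} (hGl : ∀ q : Momentum, ‖fderiv ℝ (frameLevel μ K) q‖ ≤ Gl)
    {x y : Momentum} {H W : ℝ} (hy : |frameLevel μ K y| ≤ H) (hxy : ‖y - x‖ ≤ W) {z : Momentum} (hz : z ∈ segment ℝ x y) :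
    |frameLevel μ K z| ≤ H + Gl * W := by
  have hGl0 : 0 ≤ Gl := (norm_nonneg _).trans (hGl x)
  -- `z` is within `‖x − y‖` of `y`
  have hzy : ‖z - y‖ ≤ ‖y - x‖ := by
    have hmem : z ∈ Metric.closedBall y ‖x - y‖ :=
      (convex_closedBall y ‖x - y‖).segment_subset (by simp [dist_eq_norm]) (Metric.mem_closedBall_self (norm_nonneg _)) hz
    rw [Metric.mem_closedBall, dist_eq_norm] at hmem
    rwa [norm_sub_rev y x]
  -- mean value on the segment `[y, z] ⊆ [x, y]`
  have hmv : ‖frameLevel μ K z - frameLevel μ K y‖ ≤ Gl * ‖z - y‖ :=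
    (convex_segment x y).norm_image_sub_le_of_norm_fderiv_le (fun q _ => differentiable_frameLevel μ K q) (fun q _ => hGl q)
      (right_mem_segment ℝ x y) hz
  rw [Real.norm_eq_abs] at hmv
  have h1 : |frameLevel μ K z| ≤ |frameLevel μ K y| + |frameLevel μ K z - frameLevel μ K y| := by
    have := abs_add_le (frameLevel μ K y) (frameLevel μ K z - frameLevel μ K y)
    simpa using this
  calc |frameLevel μ K z| ≤ H + Gl * ‖z - y‖ := h1.trans (add_le_add hy hmv)
    _ ≤ H + Gl * W := by nlinarith [hzy.trans hxy]

end Summit.HubbardSuperconductivity.HubbardSuperconductivity.Theorems.KLRegimeSplit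

end
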